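import Literature.Combinatorics.SimpleGraph.MengerTwo
import HarnessLib

/-!
# Prefixes of self-avoiding walks

Generic combinatorics of walks in a simple graph (topic `Literature/Combinatorics/SimpleGraph`),
written for the rerouting of two arms of the same colour in Kesten's near-critical theory on the
triangular lattice (`Literature/Probability/Percolation/TrapPairCut.lean`: P. Nolin,
*Near-critical percolation in two dimensions*, EJP 13 (2008), §4.4, proof of Lemma 15, last
paragraph), where the relative order of several distinguished vertices along an arm has to be
tracked: the prefix `p.takeUntil v` ("the arm up to `v`") is the tool, and this file collects
the facts about prefixes of a PATH that Mathlib does not state: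

* `takeUntil_end_eq_self` — a path taken until its own end is itself;
* `prefix_eq_takeUntil` — if a path splits as `p = β ++ r` at `ℓ`, then `β = p.takeUntil ℓ`;
* `mem_support_right_iff` — for such a splitting, `v ∈ r` iff `v ∈ p` and (`v ∉ β` or `v = ℓ`);
* `support_takeUntil_subset_of_mem` — if `w ∈ p.takeUntil v` then `p.takeUntil w ⊆ p.takeUntil v`
  (prefixes are nested);
* `notMem_takeUntil_of_mem_takeUntil` — if `w ∈ p.takeUntil v` and `w ≠ v` then
  `v ∉ p.takeUntil w` (Mathlib's `notMem_support_takeUntil_support_takeUntil_subset`, restated);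
* `mem_takeUntil_or` — of two vertices of a walk, one lies in the prefix of the other.

Mathlib has `takeUntil`, `dropUntil`, `take_spec`, `takeUntil_takeUntil`,
`takeUntil_append_of_mem_left`, `notMem_support_takeUntil_support_takeUntil_subset`,
`isPath_iff_nil`; the statements above are short consequences.

## References

* R. Diestel, *Graph Theory*, 5th ed., GTM 173, Springer (2017), §1.3 (paths) [Diestel2017].
* P. Nolin, Near-critical percolation in two dimensions, *Electron. J. Probab.* 13 (2008), §4.4
  [arXiv 0711.4948] [Nolin2008].
-/

namespace Literature.Combinatorics.SimpleGraph

open _root_.SimpleGraph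

variable {V : Type*} {G : _root_.SimpleGraph V} [DecidableEq V]

/-- **A path taken until its own end is itself** (its end occurs only once). [folklore] -/
theorem takeUntil_end_eq_self {u w : V} (p : G.Walk u w) (hp : p.IsPath) :
    p.takeUntil w p.end_mem_support = p := by
  have hspec := p.take_spec p.end_mem_support
  have hnil : p.dropUntil w p.end_mem_support = Walk.nil :=
    Walk.eq_nil_iff_nil.2 (Walk.isPath_iff_nil.1 (hp.dropUntil p.end_mem_support))
  rw [hnil, Walk.append_nil] at hspec
  exact hspec

/-- **The prefix of a splitting of a path is `takeUntil`**: if `p = β ++ r` with junction `ℓ`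
and `p` is a path, then `β = p.takeUntil ℓ`. [folklore] -/
theorem prefix_eq_takeUntil {u ℓ w : V} {p : G.Walk u w} {β : G.Walk u ℓ} {r : G.Walk ℓ w} (hp : p.IsPath)
    (h : p = β.append r) (hℓ : ℓ ∈ p.support) : β = p.takeUntil ℓ hℓ := by
  subst h
  have hβ : β.IsPath := (isPath_append_iff'.1 hp).1
  rw [Walk.takeUntil_append_of_mem_left β r β.end_mem_support, takeUntil_end_eq_self β hβ]

/-- **Membership in the second part of a splitting of a path.** [folklore] -/
theorem mem_support_right_iff {u ℓ w : V} {p : G.Walk u w} {β : G.Walk u ℓ} {r : G.Walk ℓ w} (hp : p.IsPath)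
    (h : p = β.append r) {v : V} : v ∈ r.support ↔ v ∈ p.support ∧ (v ∉ β.support ∨ v = ℓ) := by
  subst h
  have h3 := (isPath_append_iff'.1 hp).2.2
  rw [Walk.mem_support_append_iff]
  constructor
  · intro hv
    refine ⟨Or.inr hv, ?_⟩
    by_cases hvβ : v ∈ β.support
    · exact Or.inr (h3 v hvβ hv)
    · exact Or.inl hvβ
  · rintro ⟨hv | hv, hv'⟩
    · rcases hv' with h' | h'
      · exact absurd hv h'
      · subst h'; exact r.start_mem_support
    · exact hv

/-- **Prefixes are nested**: if `w ∈ p.takeUntil v` then `p.takeUntil w ⊆ p.takeUntil v`. [folklore] -/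
theorem support_takeUntil_subset_of_mem {u x : V} (p : G.Walk u x) {v w : V} (hv : v ∈ p.support)
    (hw : w ∈ (p.takeUntil v hv).support) :
    (p.takeUntil w (p.support_takeUntil_subset_support hv hw)).support ⊆ (p.takeUntil v hv).support := by
  rw [← Walk.takeUntil_takeUntil p hv hw]
  exact Walk.support_takeUntil_subset_support _ hw

/-- **The later vertex is not in the earlier prefix**: if `w ∈ p.takeUntil v` and `w ≠ v` then
`v ∉ p.takeUntil w`. [folklore] -/
theorem notMem_takeUntil_of_mem_takeUntil {u x : V} (p : G.Walk u x) {v w : V} (hv : v ∈ p.support)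
    (hw : w ∈ (p.takeUntil v hv).support) (hne : w ≠ v) (hw' : w ∈ p.support) :
    v ∉ (p.takeUntil w hw').support :=
  Walk.notMem_support_takeUntil_support_takeUntil_subset hne hv hw

/-- **One of two vertices of a walk lies in the prefix of the other** (prefixes up to first
occurrences are nested one way or the other). [folklore] -/
theorem mem_takeUntil_or {u x : V} (p : G.Walk u x) {v w : V} (hv : v ∈ p.support) (hw : w ∈ p.support) :
    w ∈ (p.takeUntil v hv).support ∨ v ∈ (p.takeUntil w hw).support := by
  induction p with
  | nil =>
    rw [Walk.mem_support_nil_iff] at hv hw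
    subst hv; subst hw
    exact Or.inl (by simp)
  | @cons a b c hab p ih =>
    by_cases hva : v = a
    · subst hva
      exact Or.inr (Walk.start_mem_support _)
    · by_cases hwa : w = a
      · subst hwa
        exact Or.inl (Walk.start_mem_support _)
      · have hv' : v ∈ p.support := by
          rw [Walk.support_cons, List.mem_cons] at hv
          rcases hv with h | h
          · exact absurd h hva
          · exact h
        have hw' : w ∈ p.support := by
          rw [Walk.support_cons, List.mem_cons] at hw
          rcases hw with h | h
          · exact absurd h hwa
          · exact h
        have ev : (p.cons hab).takeUntil v hv = (p.takeUntil v hv').cons hab :=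
          Walk.takeUntil_cons hv' (Ne.symm hva) hab
        have ew : (p.cons hab).takeUntil w hw = (p.takeUntil w hw').cons hab :=
          Walk.takeUntil_cons hw' (Ne.symm hwa) hab
        rcases ih hv' hw' with h | h
        · left; rw [ev, Walk.support_cons]; exact List.mem_cons_of_mem _ h
        · right; rw [ew, Walk.support_cons]; exact List.mem_cons_of_mem _ h

end Literature.Combinatorics.SimpleGraph
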